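import Mathlib
import Summits.AtomisticToContinuum.FouriersLaw.Theorems.EmbeddedDrudeMourreMourreDissolutionSlabRegionT2
import Summits.AtomisticToContinuum.FouriersLaw.Theorems.EmbeddedDrudeMourreMourreDissolutionSlabRegionT3
import Summits.AtomisticToContinuum.FouriersLaw.Theorems.EmbeddedDrudeMourreMourreDissolutionRegularValueDensity
import HarnessLib

/-!
# Slab non-concentration — `stub_slabNonconcentration` (stub NC) of line `swap-odd-threshold-rigidity`
(crux `EmbeddedDrudeMourre.MourreDissolution`, item stmt-AtomisticToContinuum-12594; helper file, `--supports`)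

Registered stub NC of the checked skeleton (lead c9), in the skeleton's stub namespace
`Summit.AtomisticToContinuum.FouriersLaw.Theorems.MourreDissolution`.

THE WEIGHTED SUBLEVEL SETS OF THE PAIR RESONANCE FUNCTION DO NOT CONCENTRATE ON THE EXCHANGE SLABS:
for `ω₂ > 0`, any couplings, a `2π`-periodic `C²` profile `f` and `ε > 0` there is `η > 0` with
`∫_{cell ∩ ({|sin((k₃−k₁)/2)| < η} ∪ {|sin((k₂−k₃)/2)| < η})} 1{|Ω − E| < r}·W ≤ ε·r` for all `E`, `r > 0`.
Assembly of the region files: the slab `{|sin((k₂−k₃)/2)| < η}` is the image of `{|sin((k₃−k₁)/2)| < η}`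
under the volume-preserving swap `(k₁,(k₃,k₂)) ↦ (k₂,(k₃,k₁))` fixing `Ω` and `W`; the latter slab is
covered by region T₁ (`k₂` far from `±κ*`), regions T₂± (`k₂` near `±κ*`, `k₃` far) and the junction
boxes T₃± (`k₂`, `k₃` near `±κ*`), whose bounds (`…SlabRegionT1/T2/T3`) are linear in `r` with
coefficients `O(η)`; the radii `ρ₁, ρ₂`, the floors `c, c_J` and the gap `γ` depend on `ω₂` only
(`…VelocityShape`). No cited facts.
-/

noncomputable section

namespace Summit.AtomisticToContinuum.FouriersLaw.Theorems.MourreDissolution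

open Real Set MeasureTheory Filter Topology
open scoped ENNReal
open Literature.MathematicalPhysics.KineticTheory.PhononBoltzmann

/-! ### The `k₁ ↔ k₂` symmetry of the two exchange slabs -/

/-- The swap `(k₁,(k₃,k₂)) ↦ (k₂,(k₃,k₁))` preserves Lebesgue measure on `ℝ³`. [folklore] -/
theorem slabNC_measurePreserving_swap13 :
    MeasurePreserving (fun p : ℝ × ℝ × ℝ => (p.2.2, (p.2.1, p.1))) volume volume := by
  have h := (regValue_measurePreserving_swap23.comp regValue_measurePreserving_swap12).comp
    regValue_measurePreserving_swap23
  have hfun : (fun p : ℝ × ℝ × ℝ => (p.2.2, (p.2.1, p.1))) =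
      (fun q : ℝ × ℝ × ℝ => (q.1, q.2.2, q.2.1)) ∘ (fun q : ℝ × ℝ × ℝ => (q.2.1, q.1, q.2.2)) ∘
        (fun q : ℝ × ℝ × ℝ => (q.1, q.2.2, q.2.1)) := by
    funext q; rfl
  rw [hfun]
  exact h

/-- **Symmetry of the two slabs.** The weighted sublevel integral over the slab `{|sin((k₂−k₃)/2)| < η}`
of the cell equals the one over `{|sin((k₃−k₁)/2)| < η}` (`Ω` and `W` are symmetric under `k₁ ↔ k₂`).
[folklore] -/
theorem slabNC_swap_eq (ω₂ a b : ℝ) (f : ℝ → ℝ) (η E r : ℝ) :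
    ∫⁻ p in (Ioc (-π) π ×ˢ (Ioc (-π) π ×ˢ Ioc (-π) π)) ∩ {p | |Real.sin ((p.2.2 - p.2.1) / 2)| < η},
        (Ioo (E - r) (E + r)).indicator 1 (resonanceFn ω₂ p.1 p.2.2 p.2.1) *
          ENNReal.ofReal (vertex a b p.1 p.2.2 p.2.1 ^ 2 /
              (dispersion ω₂ p.1 * dispersion ω₂ p.2.2 * dispersion ω₂ p.2.1 *
                dispersion ω₂ (p.1 + p.2.2 - p.2.1)) ^ 2 *
            (f p.1 + f p.2.2 - f p.2.1 - f (p.1 + p.2.2 - p.2.1)) ^ 2) =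
      ∫⁻ p in (Ioc (-π) π ×ˢ (Ioc (-π) π ×ˢ Ioc (-π) π)) ∩ {p | |Real.sin ((p.2.1 - p.1) / 2)| < η},
        (Ioo (E - r) (E + r)).indicator 1 (resonanceFn ω₂ p.1 p.2.2 p.2.1) *
          ENNReal.ofReal (vertex a b p.1 p.2.2 p.2.1 ^ 2 /
              (dispersion ω₂ p.1 * dispersion ω₂ p.2.2 * dispersion ω₂ p.2.1 *
                dispersion ω₂ (p.1 + p.2.2 - p.2.1)) ^ 2 *
            (f p.1 + f p.2.2 - f p.2.1 - f (p.1 + p.2.2 - p.2.1)) ^ 2) := by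
  set I : Set ℝ := Ioc (-π) π with hI
  set F : ℝ × ℝ × ℝ → ℝ≥0∞ := fun p => (Ioo (E - r) (E + r)).indicator 1 (resonanceFn ω₂ p.1 p.2.2 p.2.1) *
    ENNReal.ofReal (vertex a b p.1 p.2.2 p.2.1 ^ 2 /
      (dispersion ω₂ p.1 * dispersion ω₂ p.2.2 * dispersion ω₂ p.2.1 * dispersion ω₂ (p.1 + p.2.2 - p.2.1)) ^ 2 *
        (f p.1 + f p.2.2 - f p.2.1 - f (p.1 + p.2.2 - p.2.1)) ^ 2) with hF
  set σ : ℝ × ℝ × ℝ → ℝ × ℝ × ℝ := fun p => (p.2.2, (p.2.1, p.1)) with hσ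
  have hset : (I ×ˢ (I ×ˢ I)) ∩ {p | |Real.sin ((p.2.2 - p.2.1) / 2)| < η} =
      σ ⁻¹' ((I ×ˢ (I ×ˢ I)) ∩ {p | |Real.sin ((p.2.1 - p.1) / 2)| < η}) := by
    ext p
    simp only [hσ, mem_inter_iff, mem_prod, mem_setOf_eq, mem_preimage]
    rw [show (p.2.1 - p.2.2) / 2 = -((p.2.2 - p.2.1) / 2) by ring, Real.sin_neg, abs_neg]
    tauto
  have hFσ : ∀ p, F (σ p) = F p := by
    intro p
    simp only [hF, hσ, slabFibre_resonanceFn_swap12, slabFibre_vertex_swap12]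
    rw [show p.2.2 + p.1 - p.2.1 = p.1 + p.2.2 - p.2.1 by ring,
      show dispersion ω₂ p.2.2 * dispersion ω₂ p.1 = dispersion ω₂ p.1 * dispersion ω₂ p.2.2 by ring,
      show f p.2.2 + f p.1 = f p.1 + f p.2.2 by ring]
  have hσm : Measurable σ := measurable_snd.snd.prodMk (measurable_snd.fst.prodMk measurable_fst)
  let e : (ℝ × ℝ × ℝ) ≃ᵐ (ℝ × ℝ × ℝ) :=
    { toFun := σ, invFun := σ, left_inv := fun _ => rfl, right_inv := fun _ => rfl,
      measurable_toFun := hσm, measurable_invFun := hσm }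
  have hemb : MeasurableEmbedding σ := e.measurableEmbedding
  calc ∫⁻ p in (I ×ˢ (I ×ˢ I)) ∩ {p | |Real.sin ((p.2.2 - p.2.1) / 2)| < η}, F p
      = ∫⁻ p in σ ⁻¹' ((I ×ˢ (I ×ˢ I)) ∩ {p | |Real.sin ((p.2.1 - p.1) / 2)| < η}), F (σ p) := by
        rw [hset]; exact lintegral_congr fun p => (hFσ p).symm
    _ = ∫⁻ p in (I ×ˢ (I ×ˢ I)) ∩ {p | |Real.sin ((p.2.1 - p.1) / 2)| < η}, F p :=
        slabNC_measurePreserving_swap13.setLIntegral_comp_preimage_emb hemb F _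

/-! ### Cover of the exchange slab by the five regions -/

/-- The cell part of the slab `{|sin((k₃−k₁)/2)| < η}` is covered by region T₁ (`k₂` in the three far
pieces), the two near-far regions T₂± and the two junction boxes T₃±. [folklore] -/
theorem slabNC_cover (κ ρ₁ ρ₂ η : ℝ) :
    (Ioc (-π) π ×ˢ (Ioc (-π) π ×ˢ Ioc (-π) π)) ∩ {p : ℝ × ℝ × ℝ | |Real.sin ((p.2.1 - p.1) / 2)| < η} ⊆
      ((Ioc (-π) π ×ˢ (Ioc (-π) π ×ˢ Ioc (-π) π)) ∩ {p | |Real.sin ((p.2.1 - p.1) / 2)| < η} ∩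
          {p | p.2.2 ∈ Icc (-π) (-κ - ρ₁) ∪ Icc (-κ + ρ₁) (κ - ρ₁) ∪ Icc (κ + ρ₁) π}) ∪
        ((Ioc (-π) π ×ˢ (Ioc (-π) π ×ˢ Ioc (-π) π)) ∩ {p | |Real.sin ((p.2.1 - p.1) / 2)| < η} ∩
          {p | |p.2.2 - κ| ≤ ρ₁ ∧ ρ₂ ≤ |p.2.1 - κ|}) ∪
        ((Ioc (-π) π ×ˢ (Ioc (-π) π ×ˢ Ioc (-π) π)) ∩ {p | |Real.sin ((p.2.1 - p.1) / 2)| < η} ∩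
          {p | |p.2.2 - κ| ≤ ρ₁ ∧ |p.2.1 - κ| ≤ ρ₂}) ∪
        ((Ioc (-π) π ×ˢ (Ioc (-π) π ×ˢ Ioc (-π) π)) ∩ {p | |Real.sin ((p.2.1 - p.1) / 2)| < η} ∩
          {p | |p.2.2 - -κ| ≤ ρ₁ ∧ ρ₂ ≤ |p.2.1 - -κ|}) ∪
        ((Ioc (-π) π ×ˢ (Ioc (-π) π ×ˢ Ioc (-π) π)) ∩ {p | |Real.sin ((p.2.1 - p.1) / 2)| < η} ∩
          {p | |p.2.2 - -κ| ≤ ρ₁ ∧ |p.2.1 - -κ| ≤ ρ₂}) := by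
  intro p hp
  have hk₂ : p.2.2 ∈ Ioc (-π) π := hp.1.2.2
  by_cases h1 : |p.2.2 - κ| ≤ ρ₁
  · rcases le_total ρ₂ |p.2.1 - κ| with h2 | h2
    · exact Or.inl (Or.inl (Or.inl (Or.inr ⟨hp, h1, h2⟩)))
    · exact Or.inl (Or.inl (Or.inr ⟨hp, h1, h2⟩))
  · by_cases h3 : |p.2.2 - -κ| ≤ ρ₁
    · rcases le_total ρ₂ |p.2.1 - -κ| with h4 | h4
      · exact Or.inl (Or.inr ⟨hp, h3, h4⟩)
      · exact Or.inr ⟨hp, h3, h4⟩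
    · refine Or.inl (Or.inl (Or.inl (Or.inl ⟨hp, ?_⟩)))
      rw [not_le] at h1 h3
      simp only [mem_setOf_eq, mem_union, mem_Icc]
      rw [sub_neg_eq_add] at h3
      rcases lt_abs.1 h1 with h1 | h1 <;> rcases lt_abs.1 h3 with h3 | h3
      · exact Or.inr ⟨by linarith, hk₂.2⟩
      · exact Or.inr ⟨by linarith, hk₂.2⟩
      · exact Or.inl (Or.inr ⟨by linarith, by linarith⟩)
      · exact Or.inl (Or.inl ⟨hk₂.1.le, by linarith⟩)

/-! ### Small bookkeeping lemmas -/

/-- Five-piece union bound for set integrals. [folklore] -/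
theorem slabNC_sum5 {X : Type*} [MeasurableSpace X] {μ : Measure X} {F : X → ℝ≥0∞}
    {S S₁ S₂ S₃ S₄ S₅ : Set X} (hS : S ⊆ S₁ ∪ S₂ ∪ S₃ ∪ S₄ ∪ S₅) {b₁ b₂ b₃ b₄ b₅ : ℝ}
    (h0 : 0 ≤ b₁ ∧ 0 ≤ b₂ ∧ 0 ≤ b₃ ∧ 0 ≤ b₄ ∧ 0 ≤ b₅)
    (h₁ : ∫⁻ x in S₁, F x ∂μ ≤ ENNReal.ofReal b₁) (h₂ : ∫⁻ x in S₂, F x ∂μ ≤ ENNReal.ofReal b₂)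
    (h₃ : ∫⁻ x in S₃, F x ∂μ ≤ ENNReal.ofReal b₃) (h₄ : ∫⁻ x in S₄, F x ∂μ ≤ ENNReal.ofReal b₄)
    (h₅ : ∫⁻ x in S₅, F x ∂μ ≤ ENNReal.ofReal b₅) :
    ∫⁻ x in S, F x ∂μ ≤ ENNReal.ofReal (b₁ + b₂ + b₃ + b₄ + b₅) := by
  obtain ⟨h01, h02, h03, h04, h05⟩ := h0
  calc ∫⁻ x in S, F x ∂μ ≤ ∫⁻ x in S₁ ∪ S₂ ∪ S₃ ∪ S₄ ∪ S₅, F x ∂μ := lintegral_mono_set hS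
    _ ≤ (∫⁻ x in S₁ ∪ S₂ ∪ S₃ ∪ S₄, F x ∂μ) + ∫⁻ x in S₅, F x ∂μ := lintegral_union_le _ _ _
    _ ≤ (∫⁻ x in S₁ ∪ S₂ ∪ S₃, F x ∂μ) + (∫⁻ x in S₄, F x ∂μ) + ∫⁻ x in S₅, F x ∂μ := by
        gcongr; exact lintegral_union_le _ _ _
    _ ≤ (∫⁻ x in S₁ ∪ S₂, F x ∂μ) + (∫⁻ x in S₃, F x ∂μ) + (∫⁻ x in S₄, F x ∂μ) + ∫⁻ x in S₅, F x ∂μ := by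
        gcongr; exact lintegral_union_le _ _ _
    _ ≤ (∫⁻ x in S₁, F x ∂μ) + (∫⁻ x in S₂, F x ∂μ) + (∫⁻ x in S₃, F x ∂μ) + (∫⁻ x in S₄, F x ∂μ) +
          ∫⁻ x in S₅, F x ∂μ := by
        gcongr; exact lintegral_union_le _ _ _
    _ ≤ ENNReal.ofReal b₁ + ENNReal.ofReal b₂ + ENNReal.ofReal b₃ + ENNReal.ofReal b₄ + ENNReal.ofReal b₅ := by
        gcongr
    _ = ENNReal.ofReal (b₁ + b₂ + b₃ + b₄ + b₅) := by
        rw [← ENNReal.ofReal_add h01 h02, ← ENNReal.ofReal_add (by positivity) h03,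
          ← ENNReal.ofReal_add (by positivity) h04, ← ENNReal.ofReal_add (by positivity) h05]

/-- The T₁ bound is linear in `η`. [folklore] -/
theorem slabNC_b1 {Cw c η r : ℝ} (hc : 0 < c) :
    (2 * π) ^ 2 * (3 * (Cw * r * η / c)) = ((2 * π) ^ 2 * 3 * Cw / c) * η * r := by
  field_simp

/-- The T₂ bound is `≤` linear in `η` for `η ≤ 1`. [folklore] -/
theorem slabNC_b2 {Cw γ η r : ℝ} (hγ : 0 < γ) (hCw : 0 ≤ Cw) (hη0 : 0 ≤ η) (hη1 : η ≤ 1) (hr : 0 ≤ r) :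
    (2 * π) ^ 2 * (3 * (Cw * η ^ 2 * (2 * r / γ))) ≤ ((2 * π) ^ 2 * 3 * Cw * 2 / γ) * η * r := by
  rw [show (2 * π) ^ 2 * (3 * (Cw * η ^ 2 * (2 * r / γ))) = ((2 * π) ^ 2 * 3 * Cw * 2 / γ * r) * (η * η) by
    field_simp]
  have h0 : 0 ≤ (2 * π) ^ 2 * 3 * Cw * 2 / γ * r := by positivity
  calc (2 * π) ^ 2 * 3 * Cw * 2 / γ * r * (η * η) ≤ (2 * π) ^ 2 * 3 * Cw * 2 / γ * r * (η * 1) := by gcongr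
    _ = (2 * π) ^ 2 * 3 * Cw * 2 / γ * η * r := by ring

/-- The T₃ bound is `≤` linear in `η` for `η ≤ 1`. [folklore] -/
theorem slabNC_b3 {Cw cJ ρ₁ ρ₂ η r : ℝ} (hcJ : 0 < cJ) (hCw : 0 ≤ Cw) (hρ : 0 ≤ ρ₁ + ρ₂) (hη0 : 0 ≤ η)
    (hη1 : η ≤ 1) (hr : 0 ≤ r) :
    Cw * (π * η) * (ρ₁ + ρ₂) * r / (8 * cJ) * (2 * (ρ₁ + ρ₂) * (2 * (π * η))) ≤
      (Cw * π * (ρ₁ + ρ₂) / (8 * cJ) * (2 * (ρ₁ + ρ₂)) * (2 * π)) * η * r := by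
  rw [show Cw * (π * η) * (ρ₁ + ρ₂) * r / (8 * cJ) * (2 * (ρ₁ + ρ₂) * (2 * (π * η))) =
      (Cw * π * (ρ₁ + ρ₂) / (8 * cJ) * (2 * (ρ₁ + ρ₂)) * (2 * π) * r) * (η * η) by field_simp]
  have h0 : 0 ≤ Cw * π * (ρ₁ + ρ₂) / (8 * cJ) * (2 * (ρ₁ + ρ₂)) * (2 * π) * r := by positivity
  calc Cw * π * (ρ₁ + ρ₂) / (8 * cJ) * (2 * (ρ₁ + ρ₂)) * (2 * π) * r * (η * η)
      ≤ Cw * π * (ρ₁ + ρ₂) / (8 * cJ) * (2 * (ρ₁ + ρ₂)) * (2 * π) * r * (η * 1) := by gcongr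
    _ = Cw * π * (ρ₁ + ρ₂) / (8 * cJ) * (2 * (ρ₁ + ρ₂)) * (2 * π) * η * r := by ring

/-- The weight `W = Φ²(∏ω)⁻²[f]²` read at `p = (k₁,(k₃,k₂))` is measurable for continuous `f`. [folklore] -/
theorem slabNC_measurable_w {ω₂ a b : ℝ} {f : ℝ → ℝ} (hfc : Continuous f) :
    Measurable fun p : ℝ × ℝ × ℝ => ENNReal.ofReal (vertex a b p.1 p.2.2 p.2.1 ^ 2 /
      (dispersion ω₂ p.1 * dispersion ω₂ p.2.2 * dispersion ω₂ p.2.1 * dispersion ω₂ (p.1 + p.2.2 - p.2.1)) ^ 2 *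
        (f p.1 + f p.2.2 - f p.2.1 - f (p.1 + p.2.2 - p.2.1)) ^ 2) := by
  refine ENNReal.measurable_ofReal.comp (Measurable.mul (Measurable.div ?_ ?_) ?_)
  · exact Continuous.measurable (by unfold vertex; fun_prop)
  · exact Continuous.measurable (by unfold dispersion; fun_prop)
  · exact Continuous.measurable (by fun_prop)

/-! ### The core estimate on the `(k₃ − k₁)`-slab -/

/-- **Core estimate.** With all radii, floors and gaps supplied (they depend on `ω₂` only), the weighted
sublevel mass of the cell part of the slab `{|sin((k₃−k₁)/2)| < η}` is at most the sum of the five region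
bounds (T₁, T₂+, T₃+, T₂−, T₃−). [folklore] -/
theorem slabNC_core {ω₂ : ℝ} (hω : 0 < ω₂) {R ρ₁ ρ₂ d₁p d₁m γ c cJ η Cw : ℝ}
    (hc : 0 < c) (hγ : 0 < γ) (hcJ : 0 < cJ) (hCw : 0 ≤ Cw) (hη0 : 0 < η) (hη4 : η ≤ 1 / 4)
    (hηρ : π * η ≤ ρ₁ / 2) (hρ₁0 : 0 < ρ₁) (hρ₂0 : 0 < ρ₂) (hρ₁p : ρ₁ ≤ d₁p / 2) (hρ₁m : ρ₁ ≤ d₁m / 2)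
    (hρ₁ρ : ρ₁ ≤ ρ₂ / 2) (hρ₂R : ρ₂ = R / 4) (hRκ : R ≤ kappaStar ω₂ / 2)
    (hinc : ∀ t ∈ Icc (-kappaStar ω₂ + ρ₁ / 2) (kappaStar ω₂ - ρ₁ / 2), c ≤ deriv (groupVelocity ω₂) t)
    (hdec : ∀ t ∈ Icc (kappaStar ω₂ + ρ₁ / 2) (2 * π - kappaStar ω₂ - ρ₁ / 2),
      deriv (groupVelocity ω₂) t ≤ -c)
    (hgapp : ∀ u t : ℝ, |u - kappaStar ω₂| ≤ d₁p → t ∈ Icc (-π - 1) (π + 1) → ρ₂ / 2 ≤ |t - kappaStar ω₂| →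
      groupVelocity ω₂ t + γ ≤ groupVelocity ω₂ u)
    (hgapm : ∀ u t : ℝ, |u + kappaStar ω₂| ≤ d₁m → t ∈ Icc (-π - 1) (π + 1) → ρ₂ / 2 ≤ |t + kappaStar ω₂| →
      groupVelocity ω₂ u + γ ≤ groupVelocity ω₂ t)
    (hJ₁ : ∀ t ∈ Icc (kappaStar ω₂ - R) (kappaStar ω₂ + R), deriv (deriv (groupVelocity ω₂)) t ≤ -cJ)
    (hJ₂ : ∀ t ∈ Icc (-kappaStar ω₂ - R) (-kappaStar ω₂ + R), cJ ≤ deriv (deriv (groupVelocity ω₂)) t)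
    {w : ℝ × ℝ × ℝ → ℝ≥0∞} (hwm : Measurable w)
    (hw₃ : ∀ p, w p ≤ ENNReal.ofReal (Cw * Real.sin ((p.2.1 - p.1) / 2) ^ 2 *
      Real.sin ((p.2.2 - p.2.1) / 2) ^ 2)) {r : ℝ} (hr : 0 ≤ r) (E : ℝ) :
    ∫⁻ p in (Ioc (-π) π ×ˢ (Ioc (-π) π ×ˢ Ioc (-π) π)) ∩ {p | |Real.sin ((p.2.1 - p.1) / 2)| < η},
        (Ioo (E - r) (E + r)).indicator 1 (resonanceFn ω₂ p.1 p.2.2 p.2.1) * w p ≤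
      ENNReal.ofReal ((2 * π) ^ 2 * (3 * (Cw * r * η / c)) +
        (2 * π) ^ 2 * (3 * (Cw * η ^ 2 * (2 * r / γ))) +
        Cw * (π * η) * (ρ₁ + ρ₂) * r / (8 * cJ) * (2 * (ρ₁ + ρ₂) * (2 * (π * η))) +
        (2 * π) ^ 2 * (3 * (Cw * η ^ 2 * (2 * r / γ))) +
        Cw * (π * η) * (ρ₁ + ρ₂) * r / (8 * cJ) * (2 * (ρ₁ + ρ₂) * (2 * (π * η)))) := by
  have hpi := Real.pi_pos
  have hpi3 := Real.pi_gt_three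
  have hκ := velShape_kappaStar_mem hω
  have hκ2 : kappaStar ω₂ < π / 2 := (kappaStar_mem_Ioo hω).2
  have hw₁ : ∀ p, w p ≤ ENNReal.ofReal (Cw * Real.sin ((p.2.1 - p.1) / 2) ^ 2) := fun p => by
    refine (hw₃ p).trans (ENNReal.ofReal_le_ofReal ?_)
    have hs : Real.sin ((p.2.2 - p.2.1) / 2) ^ 2 ≤ 1 := by
      rw [← sq_abs]
      nlinarith [Real.abs_sin_le_one ((p.2.2 - p.2.1) / 2), abs_nonneg (Real.sin ((p.2.2 - p.2.1) / 2))]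
    have h0 : 0 ≤ Cw * Real.sin ((p.2.1 - p.1) / 2) ^ 2 := by positivity
    nlinarith
  have hT1 := slabRegion_T1 hω hc hη0 hηρ (by linarith : ρ₁ ≤ π - kappaStar ω₂) hCw hinc hdec hw₁ hr E
  have hη1 : π * η ≤ 1 := by nlinarith [Real.pi_le_four]
  have hd₁' : ρ₁ + π * η ≤ d₁p := by linarith
  have hd₁'' : ρ₁ + π * η ≤ d₁m := by linarith
  have hd₂' : ρ₂ / 2 + π * η ≤ ρ₂ := by linarith
  have hT2p := slabRegion_T2 hω hγ hη0 hη1 hd₁' hd₂' hCw (ctr := kappaStar ω₂) (Or.inl hgapp) hwm hw₁ hr E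
  have hT2m := slabRegion_T2 hω hγ hη0 hη1 hd₁'' hd₂' hCw (ctr := -kappaStar ω₂)
    (Or.inr fun u t h1 h2 h3 => by
      rw [sub_neg_eq_add] at h1 h3
      exact hgapm u t h1 h2 h3) hwm hw₁ hr E
  have hη2 : η ≤ 1 / 2 := by linarith
  have hctr : |kappaStar ω₂| + ρ₂ ≤ 2 * π / 3 := by rw [abs_of_pos hκ.1]; linarith
  have hctr' : |(-kappaStar ω₂)| + ρ₂ ≤ 2 * π / 3 := by rw [abs_neg, abs_of_pos hκ.1]; linarith
  have hRR : ρ₂ + π * η + (ρ₁ + ρ₂) ≤ R := by linarith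
  have hT3p := slabRegion_T3 hω hcJ hCw hη0 hη2 hρ₁0.le hρ₂0.le hctr hRR (ctr := kappaStar ω₂)
    (Or.inl hJ₁) hwm hw₃ hr E
  have hT3m := slabRegion_T3 hω hcJ hCw hη0 hη2 hρ₁0.le hρ₂0.le hctr' hRR (ctr := -kappaStar ω₂)
    (Or.inr hJ₂) hwm hw₃ hr E
  simp only [sub_neg_eq_add] at hT2m hT3m
  refine slabNC_sum5 (slabNC_cover (kappaStar ω₂) ρ₁ ρ₂ η)
    ⟨by positivity, by positivity, by positivity, by positivity, by positivity⟩ hT1 hT2p hT3p ?_ ?_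
  · simpa only [sub_neg_eq_add] using hT2m
  · simpa only [sub_neg_eq_add] using hT3m

/-! ### The registered stub -/

/-- **Stub NC of line `swap-odd-threshold-rigidity` (`stub_slabNonconcentration`).** For `ω₂ > 0`, any
couplings `a, b`, a `2π`-periodic `C²` profile `f` and every `ε > 0` there is `η > 0` such that for all
`E` and `r > 0` the `W`-weighted Lebesgue measure of `{|Ω − E| < r}` inside the cell part of the two
exchange slabs `{|sin((k₃−k₁)/2)| < η} ∪ {|sin((k₂−k₃)/2)| < η}` is `≤ ε·r` (points read `p = (k₁,(k₃,k₂))`,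
`W = Φ²(∏ω)⁻²[f]²`, `Ω = resonanceFn ω₂`). [folklore] -/
theorem stub_slabNonconcentration :
    ∀ ω₂ a b : ℝ, 0 < ω₂ → ∀ f : ℝ → ℝ, Function.Periodic f (2 * Real.pi) → ContDiff ℝ 2 f →
      ∀ ε : ℝ, 0 < ε → ∃ η : ℝ, 0 < η ∧ ∀ E r : ℝ, 0 < r →
        ∫⁻ p in (Set.Ioc (-Real.pi) Real.pi ×ˢ (Set.Ioc (-Real.pi) Real.pi ×ˢ Set.Ioc (-Real.pi) Real.pi)) ∩
            {p : ℝ × ℝ × ℝ | |Real.sin ((p.2.1 - p.1) / 2)| < η ∨ |Real.sin ((p.2.2 - p.2.1) / 2)| < η},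
          (Set.Ioo (E - r) (E + r)).indicator (fun _ => (1 : ENNReal)) (resonanceFn ω₂ p.1 p.2.2 p.2.1) *
            ENNReal.ofReal (vertex a b p.1 p.2.2 p.2.1 ^ 2 /
                (dispersion ω₂ p.1 * dispersion ω₂ p.2.2 * dispersion ω₂ p.2.1 *
                  dispersion ω₂ (p.1 + p.2.2 - p.2.1)) ^ 2 *
              (f p.1 + f p.2.2 - f p.2.1 - f (p.1 + p.2.2 - p.2.1)) ^ 2) ≤ ENNReal.ofReal (ε * r) := by
  intro ω₂ a b hω f hper hf ε hε
  have hpi := Real.pi_pos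
  have hpi3 := Real.pi_gt_three
  -- the weight constant
  obtain ⟨K, hK0, hKf⟩ := stub_bracketModulus f hper hf
  obtain ⟨Cw, hCw_def⟩ : ∃ Cw : ℝ, Cw = (|a| + 16 * |b|) ^ 2 * K ^ 2 / ω₂ ^ 4 := ⟨_, rfl⟩
  have hCw : 0 ≤ Cw := by rw [hCw_def]; positivity
  -- geometry of the group velocity (depends on `ω₂` only)
  have hκ := velShape_kappaStar_mem hω
  obtain ⟨R, hR_def⟩ : ∃ R : ℝ, R = min (kappaStar ω₂) (π - kappaStar ω₂) / 2 := ⟨_, rfl⟩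
  have hmin0 : 0 < min (kappaStar ω₂) (π - kappaStar ω₂) := lt_min hκ.1 (by linarith [hκ.2])
  have hR0 : 0 < R := by rw [hR_def]; positivity
  have hRκ : R ≤ kappaStar ω₂ / 2 := by
    have := min_le_left (kappaStar ω₂) (π - kappaStar ω₂); rw [hR_def]; linarith
  have hRπ : R ≤ (π - kappaStar ω₂) / 2 := by
    have := min_le_right (kappaStar ω₂) (π - kappaStar ω₂); rw [hR_def]; linarith
  -- junction floors, restricted to `[±κ − R, ±κ + R]`
  obtain ⟨cJ₁, hcJ₁, hJ₁⟩ := velShape_deriv2_floor_max hω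
  obtain ⟨cJ₂, hcJ₂, hJ₂⟩ := velShape_deriv2_floor_min hω
  have hJ₁' : ∀ t ∈ Icc (kappaStar ω₂ - R) (kappaStar ω₂ + R),
      deriv (deriv (groupVelocity ω₂)) t ≤ -min cJ₁ cJ₂ := fun t ht => by
    have := hJ₁ t ⟨by linarith [ht.1], by linarith [ht.2]⟩
    have := min_le_left cJ₁ cJ₂; linarith
  have hJ₂' : ∀ t ∈ Icc (-kappaStar ω₂ - R) (-kappaStar ω₂ + R),
      min cJ₁ cJ₂ ≤ deriv (deriv (groupVelocity ω₂)) t := fun t ht => by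
    have := hJ₂ t ⟨by linarith [ht.1], by linarith [ht.2]⟩
    have := min_le_right cJ₁ cJ₂; linarith
  -- velocity gaps at `±κ` with `d₂ = (R/4)/2`
  have hρ₂0 : 0 < R / 4 := by positivity
  obtain ⟨d₁p, hd₁p, γp, hγp, hgapp⟩ := velShape_gap_max hω (half_pos hρ₂0)
  obtain ⟨d₁m, hd₁m, γm, hγm, hgapm⟩ := velShape_gap_min hω (half_pos hρ₂0)
  have hgapp' : ∀ u t : ℝ, |u - kappaStar ω₂| ≤ d₁p → t ∈ Icc (-π - 1) (π + 1) →
      R / 4 / 2 ≤ |t - kappaStar ω₂| → groupVelocity ω₂ t + min γp γm ≤ groupVelocity ω₂ u :=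
    fun u t h1 h2 h3 => by have := hgapp u t h1 h2 h3; have := min_le_left γp γm; linarith
  have hgapm' : ∀ u t : ℝ, |u + kappaStar ω₂| ≤ d₁m → t ∈ Icc (-π - 1) (π + 1) →
      R / 4 / 2 ≤ |t + kappaStar ω₂| → groupVelocity ω₂ u + min γp γm ≤ groupVelocity ω₂ t :=
    fun u t h1 h2 h3 => by have := hgapm u t h1 h2 h3; have := min_le_right γp γm; linarith
  -- the near radius `ρ₁`
  obtain ⟨ρ₁, hρ₁_def⟩ : ∃ ρ₁ : ℝ, ρ₁ = min (min d₁p d₁m) (R / 4) / 2 := ⟨_, rfl⟩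
  have hρ₁0 : 0 < ρ₁ := by
    have := lt_min (lt_min hd₁p hd₁m) hρ₂0; rw [hρ₁_def]; positivity
  have hρ₁p : ρ₁ ≤ d₁p / 2 := by
    have := (min_le_left (min d₁p d₁m) (R / 4)).trans (min_le_left _ _); rw [hρ₁_def]; linarith
  have hρ₁m : ρ₁ ≤ d₁m / 2 := by
    have := (min_le_left (min d₁p d₁m) (R / 4)).trans (min_le_right _ _); rw [hρ₁_def]; linarith
  have hρ₁ρ : ρ₁ ≤ R / 4 / 2 := by
    have := min_le_right (min d₁p d₁m) (R / 4); rw [hρ₁_def]; linarith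
  -- floors of `|v'|` with `d = ρ₁/2`
  obtain ⟨c₁, hc₁, hinc⟩ := velShape_deriv_floor_inc hω (half_pos hρ₁0)
  obtain ⟨c₂, hc₂, hdec⟩ := velShape_deriv_floor_dec hω (half_pos hρ₁0)
  have hinc' : ∀ t ∈ Icc (-kappaStar ω₂ + ρ₁ / 2) (kappaStar ω₂ - ρ₁ / 2),
      min c₁ c₂ ≤ deriv (groupVelocity ω₂) t := fun t ht => (min_le_left c₁ c₂).trans (hinc t ht)
  have hdec' : ∀ t ∈ Icc (kappaStar ω₂ + ρ₁ / 2) (2 * π - kappaStar ω₂ - ρ₁ / 2),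
      deriv (groupVelocity ω₂) t ≤ -min c₁ c₂ := fun t ht => by
    have := hdec t ht; have := min_le_right c₁ c₂; linarith
  have hc : 0 < min c₁ c₂ := lt_min hc₁ hc₂
  have hγ : 0 < min γp γm := lt_min hγp hγm
  have hcJ : 0 < min cJ₁ cJ₂ := lt_min hcJ₁ hcJ₂
  -- the coefficient per unit `η·r` and the choice of `η`
  obtain ⟨M, hM_def⟩ : ∃ M : ℝ, M = (2 * π) ^ 2 * 3 * Cw / min c₁ c₂ +
      2 * ((2 * π) ^ 2 * 3 * Cw * 2 / min γp γm) +
      2 * (Cw * π * (ρ₁ + R / 4) / (8 * min cJ₁ cJ₂) * (2 * (ρ₁ + R / 4)) * (2 * π)) := ⟨_, rfl⟩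
  have hM0 : 0 ≤ M := by rw [hM_def]; positivity
  obtain ⟨η, hη_def⟩ : ∃ η : ℝ, η = min (min (1 / 4) (ρ₁ / (2 * π))) (ε / (2 * M + 1)) := ⟨_, rfl⟩
  have hη0 : 0 < η := by rw [hη_def]; positivity
  have hη4 : η ≤ 1 / 4 := by rw [hη_def]; exact (min_le_left _ _).trans (min_le_left _ _)
  have hηρ : π * η ≤ ρ₁ / 2 := by
    have : η ≤ ρ₁ / (2 * π) := by rw [hη_def]; exact (min_le_left _ _).trans (min_le_right _ _)
    rw [le_div_iff₀ (by positivity)] at this; linarith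
  have hηε : η ≤ ε / (2 * M + 1) := by rw [hη_def]; exact min_le_right _ _
  refine ⟨η, hη0, fun E r hr => ?_⟩
  -- the weight bound
  have hw₃ : ∀ p : ℝ × ℝ × ℝ, ENNReal.ofReal (vertex a b p.1 p.2.2 p.2.1 ^ 2 /
      (dispersion ω₂ p.1 * dispersion ω₂ p.2.2 * dispersion ω₂ p.2.1 * dispersion ω₂ (p.1 + p.2.2 - p.2.1)) ^ 2 *
        (f p.1 + f p.2.2 - f p.2.1 - f (p.1 + p.2.2 - p.2.1)) ^ 2) ≤
      ENNReal.ofReal (Cw * Real.sin ((p.2.1 - p.1) / 2) ^ 2 * Real.sin ((p.2.2 - p.2.1) / 2) ^ 2) := fun p => by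
    refine ENNReal.ofReal_le_ofReal ?_
    have := slabFibre_weight_le hω a b hK0 hKf p.1 p.2.2 p.2.1
    rw [hCw_def]; linarith
  -- the `(k₃ − k₁)`-slab
  have hcore := slabNC_core hω hc hγ hcJ hCw hη0 hη4 hηρ hρ₁0 hρ₂0 hρ₁p hρ₁m hρ₁ρ rfl hRκ hinc' hdec'
    hgapp' hgapm' hJ₁' hJ₂' (slabNC_measurable_w hf.continuous) hw₃ hr.le E
  -- real-number bookkeeping
  have hηsq : η ≤ 1 := by linarith
  have hb1 := slabNC_b1 (Cw := Cw) (η := η) (r := r) hc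
  have hb2 := slabNC_b2 (Cw := Cw) hγ hCw hη0.le hηsq hr.le
  have hb3 := slabNC_b3 (Cw := Cw) (ρ₁ := ρ₁) (ρ₂ := R / 4) hcJ hCw (by positivity) hη0.le hηsq hr.le
  have hsumM : (2 * π) ^ 2 * (3 * (Cw * r * η / min c₁ c₂)) +
        (2 * π) ^ 2 * (3 * (Cw * η ^ 2 * (2 * r / min γp γm))) +
        Cw * (π * η) * (ρ₁ + R / 4) * r / (8 * min cJ₁ cJ₂) * (2 * (ρ₁ + R / 4) * (2 * (π * η))) +
        (2 * π) ^ 2 * (3 * (Cw * η ^ 2 * (2 * r / min γp γm))) +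
        Cw * (π * η) * (ρ₁ + R / 4) * r / (8 * min cJ₁ cJ₂) * (2 * (ρ₁ + R / 4) * (2 * (π * η))) ≤
      M * η * r :=
    calc _ ≤ (2 * π) ^ 2 * 3 * Cw / min c₁ c₂ * η * r + (2 * π) ^ 2 * 3 * Cw * 2 / min γp γm * η * r +
          Cw * π * (ρ₁ + R / 4) / (8 * min cJ₁ cJ₂) * (2 * (ρ₁ + R / 4)) * (2 * π) * η * r +
          (2 * π) ^ 2 * 3 * Cw * 2 / min γp γm * η * r +
          Cw * π * (ρ₁ + R / 4) / (8 * min cJ₁ cJ₂) * (2 * (ρ₁ + R / 4)) * (2 * π) * η * r :=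
          add_le_add (add_le_add (add_le_add (add_le_add hb1.le hb2) hb3) hb2) hb3
      _ = M * η * r := by rw [hM_def]; ring
  have hD := hcore.trans (ENNReal.ofReal_le_ofReal hsumM)
  have h2M : M * η * r + M * η * r ≤ ε * r := by
    have h1 : η * (2 * M + 1) ≤ ε := by rwa [le_div_iff₀ (by positivity)] at hηε
    nlinarith
  -- both slabs
  have hsym := slabNC_swap_eq ω₂ a b f η E r
  rw [show (fun _ : ℝ => (1 : ENNReal)) = (1 : ℝ → ℝ≥0∞) from rfl, setOf_or, inter_union_distrib_left]
  refine (lintegral_union_le _ _ _).trans ?_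
  rw [hsym]
  calc _ ≤ ENNReal.ofReal (M * η * r) + ENNReal.ofReal (M * η * r) := add_le_add hD hD
    _ = ENNReal.ofReal (M * η * r + M * η * r) := (ENNReal.ofReal_add (by positivity) (by positivity)).symm
    _ ≤ ENNReal.ofReal (ε * r) := ENNReal.ofReal_le_ofReal h2M

end Summit.AtomisticToContinuum.FouriersLaw.Theorems.MourreDissolution
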